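import Mathlib
import Summits.NavierStokesRegularity.NavierStokesRegularity.Theorems.TypeIQuarterGateScarEnvelopeTypeIBudgetCompactnessSharp
import Summits.NavierStokesRegularity.NavierStokesRegularity.Theorems.TypeIQuarterGateScarEnvelopeTypeISatelliteTowerAttainment

/-!
# Satellite tower for crux `ScarEnvelopeTypeI` (stmt-NavierStokesRegularity-23843) — Part S2–S3: the A–B class is sequentially closed AT EVERY ENERGY LEVEL; re-classing does not raise the energy

Part S2–S3 of nsreg-p3's ROUND-38 artefact (section `Level`): S2 ★★ `abSeq_closed` (sequence closure of the A–B class at a fixed energy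
level `{𝐈 ≤ I}`, singular origin persists; via Part S1), `exists_rootObj_of_tendsto_sharp` (`𝐈 ≤ I`); S3 `ABTower.reclass_level_aux`,
★★ `ABTower.reclass_level` (re-classing at a scar does NOT raise `𝐈`: zooms have the same `𝐈`).

PROVENANCE: declaration texts VERBATIM from the HOME artefact of the instrument seat nsreg-p3 g27 (cell `pub/ns-regularity-ideate`):
`round-38/CritRate38.lean` (sha16 `30eed4aabab5065a`, a standalone module written against the TREE; memo `round-38/ROUND-38.md`
4eff55037f29b2fe), scored by referee ref3 g27 (`SCORE-p3-ROUND-38-0828.md`); the author cannot write under `Theorems/`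
(`perm.theorems-prover-only`); landed by the prover ns-es-p1 g5 as landing hand of record (director-ns DIRECTOR-NS #237 (3)), split into
≤ 400-line modules, `E3` spelled out, the artefact's `#guard_msgs … #print axioms` certificates not landed.
`--supports stmt-NavierStokesRegularity-23843 --as helper`.

HONEST FRAMING: instrument theorems about HYPOTHETICAL Type-I zoom limits (Albritton–Barker objects of the census of crux
`TypeIQuarterGate.ScarEnvelopeTypeI`, item 23843); the analytic input is the tree's closure engine (compactness
`local_typeI_compactness_twin_inBall`, sharpened to constant 1 in Part S1; Q1 whole-space), P1 rate inheritance, L8 persistence and the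
tree's PROVED small-constant Liouville theorem; Parts R/S are order theory on the re-classing and closure lemmas.  NOTHING OPEN IS
PROVED: 23843, (L′) `TypeILiouvilleAB` / (L′₀), the GLOBAL (S∞) = `CritAttained`, (M𝐈₁), (E1⁺), (E2ᵣ), route ExtremalTypeIConstant's
cruxes, N0 and Navier–Stokes regularity are OPEN; `critRate`, `levelCrit I`, `liouvilleRate` are `sInf`s that are `0` by junk value
when the defining set is empty (every statement using them carries the nonemptiness hypothesis explicitly).
-/

-- the summit-side namespace repeats a component by design (single-conjunct summit, D-0017)
set_option linter.dupNamespace false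

open MeasureTheory Set Metric Filter Topology
open scoped ENNReal NNReal InnerProductSpace
open Literature.Analysis.FluidPDE

namespace Summit.NavierStokesRegularity.NavierStokesRegularity.Cruxes.ScarEnvelopeTypeI.ZoomDictionary

section Level

variable {U : ℝ → (EuclideanSpace ℝ (Fin 3)) → (EuclideanSpace ℝ (Fin 3))} {P : ℝ → (EuclideanSpace ℝ (Fin 3)) → ℝ}

/-! ## Part S. ENERGY IS MONOTONE ALONG THE TOWER ⇒ THE ENERGY-GRADED CRITICAL RATE IS ATTAINED

With the SHARP compactness theorem S1 (constant `1` in the energy bound of the limit) every move of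
Parts Q/R — passing to an A–B limit of a sequence (S2), re-classing at a scar (S3) — is NON-INCREASING
in the Type-I energy `𝐈`.  Hence the critical-rate theory of Part R can be run INSIDE AN ENERGY LEVEL
`{𝐈 ≤ I}`, where the energy hypothesis of R8 is automatic: the level-`I` critical rate
`M_c(I) := inf {tightRate U y : (U, y) a scar of an A–B object with 𝐈(U) ≤ I}` is ATTAINED, by a root
object ALL of whose scars are EXACTLY `M_c(I)`-rated (S5) — the (S∞) statement of ROUNDS 35–37 holds
unconditionally in energy-graded form; the global (S∞) (`CritAttained`) is exactly the statement that
the non-increasing level profile `I ↦ M_c(I)` attains its infimum `M_c` at a finite level (S6). -/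

/-- ★★ **S2. SEQUENCE CLOSURE OF THE A–B CLASS AT A FIXED ENERGY LEVEL (sharp).**  A sequence of
A–B objects of classes `M_k → M_∞` with `𝐈 ≤ I < ∞` has, along a subsequence, an `L³_loc` limit
(continuous Oseen-mild representative) which is an A–B object of class `M_∞` WITH `𝐈 ≤ I` (same `I`:
S1); if every approximant is singular at the origin, so is the limit. -/
theorem abSeq_closed {Ms : ℕ → ℝ} {Minf : ℝ} {I : ℝ≥0∞} (hI : I < ⊤)
    (v : ℕ → ℝ → (EuclideanSpace ℝ (Fin 3)) → (EuclideanSpace ℝ (Fin 3))) (q : ℕ → ℝ → (EuclideanSpace ℝ (Fin 3)) → ℝ) (Gz : ℕ → ℝ → (EuclideanSpace ℝ (Fin 3)) → (EuclideanSpace ℝ (Fin 3)) →L[ℝ] (EuclideanSpace ℝ (Fin 3)))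
    (hAB : ∀ k, ABTower (Ms k) (v k) (q k) (Gz k))
    (hbd : ∀ k, typeIBound (Iio (0 : ℝ) ×ˢ univ) (v k) (q k) (Gz k) ≤ I)
    (hM : Tendsto Ms atTop (𝓝 Minf)) :
    ∃ (U' : ℝ → (EuclideanSpace ℝ (Fin 3)) → (EuclideanSpace ℝ (Fin 3))) (P' : ℝ → (EuclideanSpace ℝ (Fin 3)) → ℝ) (H' : ℝ → (EuclideanSpace ℝ (Fin 3)) → (EuclideanSpace ℝ (Fin 3)) →L[ℝ] (EuclideanSpace ℝ (Fin 3))) (σ : ℕ → ℕ),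
      StrictMono σ ∧ ABTower Minf U' P' H' ∧ typeIBound (Iio (0 : ℝ) ×ˢ univ) U' P' H' ≤ I ∧
      (∀ R : ℝ, 0 < R → MemLp (Function.uncurry U') 3
        (volume.restrict (parabolicCylinder R (0 : ℝ × (EuclideanSpace ℝ (Fin 3)))))) ∧
      (∀ R : ℝ, 0 < R → Tendsto (fun j => eLpNorm
        (Function.uncurry (v (σ j)) - Function.uncurry U') 3
        (volume.restrict (parabolicCylinder R (0 : ℝ × (EuclideanSpace ℝ (Fin 3)))))) atTop (𝓝 0)) ∧
      ((∀ k, ¬ RegPt (v k) 0) → ¬ RegPt U' 0) := by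
  have hcc_pos : ∀ m : ℕ, (0 : ℝ) < (2 : ℝ) ^ m := fun m => by positivity
  have hballs : ∀ m k : ℕ, IsSuitableWeakSolutionInBall ((2 : ℝ) ^ m) (0 : ℝ × (EuclideanSpace ℝ (Fin 3))) (v k) (q k) :=
    fun m k => (hAB k).2.1 _ (hcc_pos m)
  have hQsl : ∀ ρ : ℝ, (parabolicCylinderOpens ρ (0 : ℝ × (EuclideanSpace ℝ (Fin 3))) : TopologicalSpace.Opens (ℝ × (EuclideanSpace ℝ (Fin 3)))) ≤
      slab (EuclideanSpace ℝ (Fin 3)) (Iio 0) isOpen_Iio := fun ρ w hw => parabolicCylinder_origin_subset_slab ρ hw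
  have hgrads : ∀ m k : ℕ,
      HasWeakSpatialGradientOn (parabolicCylinderOpens ((2 : ℝ) ^ m) (0 : ℝ × (EuclideanSpace ℝ (Fin 3)))) (v k) (Gz k) :=
    fun m k => (hAB k).2.2.1.mono (hQsl _)
  have hIs : ∀ m k : ℕ,
      typeIBound (parabolicCylinder ((2 : ℝ) ^ m) (0 : ℝ × (EuclideanSpace ℝ (Fin 3)))) (v k) (q k) (Gz k) ≤ I :=
    fun m k => (typeIBound_mono (parabolicCylinder_origin_subset_slab _)).trans (hbd k)
  -- ## SHARP compactness with the class on all balls (S1)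
  obtain ⟨Ut, Pt, Ht, σ, hσ, hIBU, hswU, hHU, h4I, hmemU, hconvU, hpers⟩ :=
    Summit.NavierStokesRegularity.NavierStokesRegularity.Cruxes.ScarEnvelopeTypeI.SliceBudget.local_typeI_compactness_twin_inBall_sharp
      I v q Gz hI (fun m k _ => hballs m k) (fun m k _ => hgrads m k) (fun m k _ => hIs m k)
  -- ## nonnegativity of the classes and of the limit class
  have hMk : ∀ k, 0 ≤ Ms k := fun k => by
    have h := (hAB k).1.2.2.2 (-1) (by norm_num) 0
    rw [neg_neg, Real.sqrt_one, div_one] at h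
    exact (norm_nonneg _).trans h
  have hMinf : 0 ≤ Minf := ge_of_tendsto' hM hMk
  -- ## the rate `M_∞/√(−t)` of the limit, a.e.
  have hrate_ae : ∀ᵐ w ∂(volume.restrict (Iio (0 : ℝ) ×ˢ (univ : Set (EuclideanSpace ℝ (Fin 3))))),
      ‖Ut w.1 w.2‖ ≤ Minf / Real.sqrt (-w.1) := by
    have hQ : ∀ m : ℕ, ∀ᵐ w ∂(volume.restrict (parabolicCylinder ((2 : ℝ) ^ m) (0 : ℝ × (EuclideanSpace ℝ (Fin 3))))),
        ‖Ut w.1 w.2‖ ≤ Minf / Real.sqrt (-w.1) := by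
      intro m
      have hmeas : ∀ j, AEStronglyMeasurable (Function.uncurry (v (σ j)))
          (volume.restrict (parabolicCylinder ((2 : ℝ) ^ m) (0 : ℝ × (EuclideanSpace ℝ (Fin 3))))) := fun j =>
        (hballs m (σ j)).1.distributional.1.aestronglyMeasurable
      obtain ⟨ψ, hψ, hae⟩ := exists_subseq_tendsto_ae₃ hmeas (hmemU _ (hcc_pos m)).1
        (hconvU _ (hcc_pos m))
      filter_upwards [hae, ae_restrict_mem (isOpen_parabolicCylinder _ _).measurableSet]
        with w hw hwmem
      have hw0 : w.1 < 0 := by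
        have h1 := ((mem_parabolicCylinder).1 hwmem).1.2
        simpa using h1
      have hlim : Tendsto (fun i => Ms (σ (ψ i)) / Real.sqrt (-w.1)) atTop
          (𝓝 (Minf / Real.sqrt (-w.1))) :=
        ((hM.comp hσ.tendsto_atTop).comp hψ.tendsto_atTop).div_const _
      exact le_of_tendsto_of_tendsto hw.norm hlim
        (Eventually.of_forall fun i => (hAB (σ (ψ i))).1.2.2.2 _ hw0 _)
    have hcover : (Iio (0 : ℝ) ×ˢ (univ : Set (EuclideanSpace ℝ (Fin 3)))) ⊆
        ⋃ m : ℕ, parabolicCylinder ((2 : ℝ) ^ m) (0 : ℝ × (EuclideanSpace ℝ (Fin 3))) := by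
      rintro ⟨t, x⟩ ⟨ht', -⟩
      obtain ⟨m, hm⟩ := exists_mem_parabolicCylinder_two_pow₃ (mem_Iio.1 ht') x
      exact mem_iUnion.2 ⟨m, hm⟩
    exact ae_restrict_of_ae_restrict_of_subset hcover ((ae_restrict_iUnion_iff _ _).2 hQ)
  -- ## representatives: the rate everywhere, then continuous Oseen-mild (KNSS)
  obtain ⟨U₁, hae₁, hdec₁⟩ := exists_repr_hasTypeITimeDecay hMinf hrate_ae
  have hae₁' : ∀ᵐ w ∂(volume.restrict ((slab (EuclideanSpace ℝ (Fin 3)) (Iio 0) isOpen_Iio :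
      TopologicalSpace.Opens (ℝ × (EuclideanSpace ℝ (Fin 3)))) : Set (ℝ × (EuclideanSpace ℝ (Fin 3))))),
      Function.uncurry Ut w = Function.uncurry U₁ w := by
    rw [coe_slab]
    exact hae₁
  have hsw₁ : IsSuitableWeakSolutionOn (slab (EuclideanSpace ℝ (Fin 3)) (Iio 0) isOpen_Iio) 1 0 U₁ Pt :=
    hswU.congr_ae hae₁' (ae_of_all _ fun _ => rfl)
  have hI₁ : typeIBound (Iio (0 : ℝ) ×ˢ univ) U₁ Pt Ht < ⊤ := by
    rw [← typeIBound_congr_ae hae₁]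
    exact lt_of_le_of_lt h4I hI
  obtain ⟨U', hae₂, hUc, hUdiv, hUmild, hUrate⟩ :=
    exists_oseenMild_repr_of_typeIBound_lt_top hsw₁ hdec₁ hI₁
  have hae : ∀ᵐ w ∂(volume.restrict (Iio (0 : ℝ) ×ˢ (univ : Set (EuclideanSpace ℝ (Fin 3))))),
      Function.uncurry Ut w = Function.uncurry U' w := by
    filter_upwards [hae₁, hae₂] with w h1 h2
    rw [h1, h2]
  have hae' : ∀ᵐ w ∂(volume.restrict ((slab (EuclideanSpace ℝ (Fin 3)) (Iio 0) isOpen_Iio :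
      TopologicalSpace.Opens (ℝ × (EuclideanSpace ℝ (Fin 3)))) : Set (ℝ × (EuclideanSpace ℝ (Fin 3))))),
      Function.uncurry Ut w = Function.uncurry U' w := by
    rw [coe_slab]
    exact hae
  have hTI : IsTypeIAncientMild Minf U' :=
    LocalTypeIBlowup.isTypeIAncientMild_of_continuous_oseenMild_rate hUc hUdiv hUmild hUrate
  have hIBU' : ∀ a : ℝ, 0 < a → IsSuitableWeakSolutionInBall a (0 : ℝ × (EuclideanSpace ℝ (Fin 3))) U' Pt := fun a ha =>
    (hIBU a ha).congr_ae'
      (ae_restrict_of_ae_restrict_of_subset (parabolicCylinder_origin_subset_slab a) hae)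
      (ae_of_all _ fun _ => rfl)
  have hHU' : HasWeakSpatialGradientOn (slab (EuclideanSpace ℝ (Fin 3)) (Iio 0) isOpen_Iio) U' Ht := hHU.congr_ae hae'
  have hIU'le : typeIBound (Iio (0 : ℝ) ×ˢ univ) U' Pt Ht ≤ I := by
    rw [← typeIBound_congr_ae hae]
    exact h4I
  have hIU' : typeIBound (Iio (0 : ℝ) ×ˢ univ) U' Pt Ht < ⊤ := lt_of_le_of_lt hIU'le hI
  refine ⟨U', Pt, Ht, σ, hσ, ⟨hTI, hIBU', hHU', hIU'⟩, hIU'le, fun R hR => ?_, fun R hR => ?_,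
    fun hsing => ?_⟩
  · -- `U' ∈ L³(Q_R(0))` for every `R > 0`
    exact (hmemU R hR).ae_eq
      (ae_restrict_of_ae_restrict_of_subset (parabolicCylinder_origin_subset_slab R) hae)
  · -- `L³_loc` convergence along `σ` to the representative
    have haeR : ∀ᵐ w ∂(volume.restrict (parabolicCylinder R (0 : ℝ × (EuclideanSpace ℝ (Fin 3))))),
        Function.uncurry Ut w = Function.uncurry U' w :=
      ae_restrict_of_ae_restrict_of_subset (parabolicCylinder_origin_subset_slab R) hae
    refine (hconvU R hR).congr' (Eventually.of_forall fun j => ?_)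
    exact eLpNorm_congr_ae (haeR.mono fun w hw => by simp only [Pi.sub_apply, hw])
  · -- ## the origin stays singular
    have hsingU : IsBackwardSingularPoint Ut (0 : ℝ × (EuclideanSpace ℝ (Fin 3))) := by
      refine hpers 0 (by simp) fun R hR => ?_
      have hc : ∀ j, eLpNorm (Function.uncurry (v (σ j))) ⊤
          (volume.restrict (parabolicCylinder R (0 : ℝ × (EuclideanSpace ℝ (Fin 3))))) = ⊤ := fun j =>
        eLpNorm_top_eq_top_of_not_regPt (hsing _) hR.1
      simp only [hc, Filter.limsup_const]
    intro hr
    apply not_regPt_zero_of_isBackwardSingularPoint hsingU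
    have haeR : ∀ R ∈ Ioo (0 : ℝ) 1,
        ∀ᵐ z ∂(volume.restrict (parabolicCylinder R (0 : ℝ × (EuclideanSpace ℝ (Fin 3))))), Ut z.1 z.2 = U' z.1 z.2 :=
      fun R _ => (ae_restrict_of_ae_restrict_of_subset (parabolicCylinder_origin_subset_slab R)
        hae).mono fun w hw => hw
    exact (regPt_iff_of_ae_eq_of_norm_lt_one haeR (by simp)).2 hr

/-- ★★ **S2'. (R8 sharpened)** a sequence of ROOT objects of classes `M_k → M_∞` at level `𝐈 ≤ I`
has a ROOT-object limit of class `M_∞` AT THE SAME LEVEL `𝐈 ≤ I`. -/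
theorem exists_rootObj_of_tendsto_sharp {Ms : ℕ → ℝ} {Minf : ℝ} {I : ℝ≥0∞} (hI : I < ⊤)
    (n : ℕ → TNode) (hn : ∀ k, RootObj (Ms k) (n k))
    (hbd : ∀ k, typeIBound (Iio (0 : ℝ) ×ˢ univ) (n k).U (n k).P (n k).H ≤ I)
    (hM : Tendsto Ms atTop (𝓝 Minf)) :
    ∃ n' : TNode, RootObj Minf n' ∧ typeIBound (Iio (0 : ℝ) ×ˢ univ) n'.U n'.P n'.H ≤ I := by
  obtain ⟨U', P', H', σ, -, hT', hI', -, -, hpers⟩ :=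
    abSeq_closed hI (fun k => (n k).U) (fun k => (n k).P) (fun k => (n k).H) (fun k => (hn k).1)
      hbd hM
  exact ⟨⟨U', P', H', 0⟩, ⟨hT', hpers fun k => (hn k).2⟩, hI'⟩

/-- S3 (helper, explicit scales). -/
theorem ABTower.reclass_level_aux {M : ℝ} {H : ℝ → (EuclideanSpace ℝ (Fin 3)) → (EuclideanSpace ℝ (Fin 3)) →L[ℝ] (EuclideanSpace ℝ (Fin 3))} (hT : ABTower M U P H)
    (y' : (EuclideanSpace ℝ (Fin 3))) {L : ℕ → ℝ} (hLpos : ∀ k, 0 < L k) (hL0 : Tendsto L atTop (𝓝 0)) :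
    ∃ (U' : ℝ → (EuclideanSpace ℝ (Fin 3)) → (EuclideanSpace ℝ (Fin 3))) (P' : ℝ → (EuclideanSpace ℝ (Fin 3)) → ℝ) (H' : ℝ → (EuclideanSpace ℝ (Fin 3)) → (EuclideanSpace ℝ (Fin 3)) →L[ℝ] (EuclideanSpace ℝ (Fin 3))),
      ABTower (tightRate U y') U' P' H' ∧
      typeIBound (Iio (0 : ℝ) ×ˢ univ) U' P' H' ≤ typeIBound (Iio (0 : ℝ) ×ˢ univ) U P H ∧
      (¬ RegPt U y' → ¬ RegPt U' 0) := by
  have hTO : TowerObj M U P := towerObj_of_abTower hT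
  have hI₀ : typeIBound (Iio (0 : ℝ) ×ˢ univ) U P H < ⊤ := hT.2.2.2
  -- the zooms about `(0, y')` as A–B objects of class `M` AT THE SAME LEVEL
  have hABk : ∀ k, ABTower M (zoom U y' 0 (L k)) (zoomP P y' 0 (L k))
      (L k ^ 2 • stPull (L k ^ 2) (L k) (0 : ℝ) y' H) := fun k => by
    rw [zoom_eq_smul_stPull, zoomP_eq_smul_stPull]
    exact abTower_zoom hT y' (hLpos k)
  have hbdk : ∀ k, typeIBound (Iio (0 : ℝ) ×ˢ univ) (zoom U y' 0 (L k)) (zoomP P y' 0 (L k))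
      (L k ^ 2 • stPull (L k ^ 2) (L k) (0 : ℝ) y' H) ≤ typeIBound (Iio (0 : ℝ) ×ˢ univ) U P H := by
    intro k
    rw [zoom_eq_smul_stPull, zoomP_eq_smul_stPull,
      ← typeIBound_nsZoom (hLpos k) (0 : ℝ) y' (Iio (0 : ℝ) ×ˢ univ) U P H,
      stAffine_preimage_lowerSlab (hLpos k) y']
  obtain ⟨U', P', H', σ, hσ, hT', hI', -, hconv', hpers⟩ :=
    abSeq_closed hI₀ _ _ _ hABk hbdk (tendsto_const_nhds (x := M))
  have hLσpos : ∀ k, 0 < L (σ k) := fun k => hLpos (σ k)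
  have hLσ0 : Tendsto (fun k => L (σ k)) atTop (𝓝 0) := hL0.comp hσ.tendsto_atTop
  have hcU : ContinuousOn (Function.uncurry U) (Iio 0 ×ˢ univ) := hT.1.1.continuousOn
  have hcU' : ContinuousOn (Function.uncurry U') (Iio 0 ×ˢ univ) := hT'.1.1.continuousOn
  -- every constant above the tight rate of `y'` is a rate of `U'` on every `Q_R(0)`
  have hall : ∀ m : ℝ, tightRate U y' < m → ∀ R : ℝ, 0 < R → ∀ t ∈ Ioo (-(R ^ 2)) 0,
      ∀ x ∈ ball (0 : (EuclideanSpace ℝ (Fin 3))) R, Real.sqrt (-t) * ‖U' t x‖ ≤ m := by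
    intro m hm R hR
    obtain ⟨δ, hδ, hrate⟩ := hTO.rateAt_of_tightRate_lt hm
    have hmeasU' : AEStronglyMeasurable (Function.uncurry U')
        (volume.restrict (parabolicCylinder R (0 : ℝ × (EuclideanSpace ℝ (Fin 3))))) :=
      (hcU'.mono (parabolicCylinder_subset_lowerHalf R (0 : (EuclideanSpace ℝ (Fin 3))))).aestronglyMeasurable
        (isOpen_parabolicCylinder R _).measurableSet
    exact rate_everywhere_of_ae hcU'
      (rate_of_zooms hcU hLσpos hLσ0 hR hmeasU' (hconv' R hR) hδ hrate)
  have hall' : ∀ R : ℝ, 0 < R → ∀ t ∈ Ioo (-(R ^ 2)) 0, ∀ x ∈ ball (0 : (EuclideanSpace ℝ (Fin 3))) R,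
      Real.sqrt (-t) * ‖U' t x‖ ≤ tightRate U y' := fun R hR t ht x hx =>
    le_of_forall_gt_imp_ge_of_dense fun m hm => hall m hm R hR t ht x hx
  have hdec : HasTypeITimeDecay (tightRate U y') U' := hasTypeITimeDecay_of_rates hall'
  refine ⟨U', P', H', ⟨⟨hT'.1.1, hT'.1.2.1, hT'.1.2.2.1, hdec⟩, hT'.2.1, hT'.2.2.1, hT'.2.2.2⟩,
    hI', fun hy => hpers fun k hk => hy (regPt_of_regPt_zoom_zero (hLpos k) hk)⟩

/-- ★★ **S3. RE-CLASSING AT A SCAR DOES NOT RAISE THE ENERGY.**  R2 with the level: the tangent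
A–B representative at `y'` has class `tightRate U y'`, is singular at `0` if `y'` is, AND has
`𝐈 ≤ 𝐈(U)`. -/
theorem ABTower.reclass_level {M : ℝ} {H : ℝ → (EuclideanSpace ℝ (Fin 3)) → (EuclideanSpace ℝ (Fin 3)) →L[ℝ] (EuclideanSpace ℝ (Fin 3))} (hT : ABTower M U P H) (y' : (EuclideanSpace ℝ (Fin 3))) :
    ∃ (U' : ℝ → (EuclideanSpace ℝ (Fin 3)) → (EuclideanSpace ℝ (Fin 3))) (P' : ℝ → (EuclideanSpace ℝ (Fin 3)) → ℝ) (H' : ℝ → (EuclideanSpace ℝ (Fin 3)) → (EuclideanSpace ℝ (Fin 3)) →L[ℝ] (EuclideanSpace ℝ (Fin 3))),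
      ABTower (tightRate U y') U' P' H' ∧
      typeIBound (Iio (0 : ℝ) ×ˢ univ) U' P' H' ≤ typeIBound (Iio (0 : ℝ) ×ˢ univ) U P H ∧
      (¬ RegPt U y' → ¬ RegPt U' 0) :=
  hT.reclass_level_aux y' (L := fun k => 1 / ((k : ℝ) + 1)) (fun k => by positivity)
    (tendsto_one_div_add_atTop_nhds_zero_nat (𝕜 := ℝ))

end Level

end Summit.NavierStokesRegularity.NavierStokesRegularity.Cruxes.ScarEnvelopeTypeI.ZoomDictionary
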